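import Summits.BirchSwinnertonDyer.BirchSwinnertonDyer.Theorems.ManinLocalTwoThreeCuspZeroAnnihilatorOfCuspGalois
import Summits.BirchSwinnertonDyer.BirchSwinnertonDyer.Theorems.ManinLocalTwoThreeShimuraQuotientFrickeParity
import Summits.BirchSwinnertonDyer.BirchSwinnertonDyer.Theorems.ManinLocalTwoThreeShimuraQuotientLevelInstances
import Summits.BirchSwinnertonDyer.BirchSwinnertonDyer.Theorems.ManinLocalTwoThreeGammaOneIndexFour
import Literature.NumberTheory.EllipticCurves.Gamma1ParametrizationCuspZeroGaloisOrbit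
import Literature.NumberTheory.EllipticCurves.ManinConstantGamma1Gamma0LedgerProofs
import Literature.NumberTheory.EllipticCurves.KuriharaNumberParityProofs
import HarnessLib

/-!
# STEVENS' CURVE IS THE OPTIMAL CURVE WHENEVER THE CUSP `0` MAPS TO THE ORIGIN — in particular for EVERY optimal curve of ROOT NUMBER `−1`
# (odd analytic rank): `Λ₁(f) = Λ₀(f)` and `|c₀| = |c₁|`, modulo the three PRINTED facts F★, F♮, CES; so the Shimura `2`-kernel of C2 and the
# `3`-kernel of C3 live ONLY on curves with `L(E,1) ≠ 0` whose cuspidal point `φ₀(0) ∈ E₀(ℚ)` has order divisible by `2` (resp. `3`)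
(route `ManinLocalTwoThree`, cruxes C2 `ManinOddAtFour` stmt-BirchSwinnertonDyer-22967 and C3 stmt-…-22968; cell bsd-f2-manin, C2/C3 LEAD p1 gen 18;
`--supports stmt-BirchSwinnertonDyer-22967`; a corollary of es's annihilator law Θ as PROVED from print by an g41 / p3 g17
(`…CuspZeroAnnihilatorOfCuspGalois.cuspZeroAnnihilates_of_latticeOptimal`, p743718: `m·{∞,0}_f ∈ Λ₀(f) ⟹ m·Λ₀(f) ⊆ Λ₁(f)`) at `m = 1`)

THE OBSERVATION.  Θ at `m = 1` reads: **if `{∞,0}_f ∈ Λ₀(f)` — i.e. the cusp `0` of `X₀(N)` maps to the ORIGIN of the optimal curve `E₀ = ℂ/c₀Λ₀(f)`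
— then `Λ₀(f) ⊆ Λ₁(f)`, so `Λ₁(f) = Λ₀(f)`: Stevens' `X₁(N)`-optimal curve IS the `X₀(N)`-optimal curve** (§1).  This happens whenever `{∞,0}_f = 0`,
e.g. for every `w_N`-PLUS newform (`(1 + ε)·{∞,0}_f = 0`, tree `one_add_mul_modularSymbol_zero_eq_zero`), i.e. (at the conductor level) for every
optimal curve of ROOT NUMBER `w(E) = −ε = −1` — odd analytic rank (§2).  Consequences:
* §3 **E-an-151 `GammaOneTransferAtFour` (`|c₀| = |c₁|`) holds modulo print on the whole locus `φ₀(0) = O`**, in particular for every optimal curve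
  of root number `−1` at ANY level (`natAbs_maninConstant₀_eq_of_rootNumber_eq_neg_one_of_print`); there C2 (`2 ∤ c₀`) and Stevens' `2 ∤ c₁` are the
  SAME statement about the SAME curve.
* §4 at `4 ∣ N` (`2Λ₀ ⊆ Λ₁`): `Λ₁ ≠ Λ₀` ⟹ EVERY `m` with `m·{∞,0}_f ∈ Λ₀(f)` is EVEN — the cuspidal point `φ₀(0) ∈ E₀(ℚ)_tors` (Manin–Drinfeld) has
  EVEN order, so `{∞,0}_f ∉ Λ₀(f)`, `L(f,1) = −{…}` is non-zero (analytic rank `0`) and `E₀(ℚ)` has a point of even order; at `9 ∣ N`: `Λ₁ ≠ Λ₀` ⟹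
  `3 ∣ m` for every such `m`.  So the open rows E-an-152/152b/153 of C2 (and E-an-221's habitat at `3`) concern ONLY analytic-rank-`0` optimal curves
  whose cuspidal point has order divisible by `2` (resp. `3`) — CENSUS: all 143 classes with `Λ₁ ≠ Λ₀` in es's E15 table (N ≤ 80153) have rank `0`
  and `[Λ₀:Λ₁] ∣ #E₀(ℚ)_tors` (E15 summary rows «rank», «tor»).
HONEST FRAMING.  CONDITIONAL on three statement-only PRINTED Literature facts — F★ `optimalGamma1Parametrization_cusp_rational` (CES 2003 §6.1.2),
F♮ `optimalGamma1Parametrization_cuspZero_galoisConjugate` (Stevens 1982 Thm 1.3.1 (b)), CES `exists_optimal_gamma1ParametrizationData` (CES 2003 /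
Stevens 1989 Thm 1.9) — exactly the cusp facts already on C3's skeleton v34 and (F★, CES) on C2's v23.  Which root-number-`+1` curves have `Λ₁ ≠ Λ₀` is
NOT decided; C2, C3, Stevens' conjecture, Manin's conjecture and BSD are NOT proved.  No definitions, no sorry.
NEAREST PRINT: Stevens 1989 §2 / Vatsal 2005 Rem. 1.8 (the Shimura cover `E₁ → E₀` has constant kernel generated by cusp differences); the
root-number / `φ₀(0) = O` formulation is not stated there (presearch 2026-08-29: `lit search --hybrid "Stevens X_1(N)-optimal curve equals X_0(N)-optimal curve
positive rank root number"` → Delbourgo 2008 p. 287, Cornell–Silverman–Stevens 1997 — no such statement; `lit galaxy search "X_1(N)-optimal|Stevens curve|optimal X_1"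
--star all` → 0 relevant hits).
[cite: Stevens1982, Thm. 1.3.1] [cite: Stevens1989, Thm. 1.9 and §2] [cite: ConradEdixhovenStein2003, §6.1.2 and Thm. 1.1.3]
[cite: Vatsal2005, Rem. 1.8] [cite: AtkinLehner1970, Thm. 3] [cite: Manin1972, Thm. 3.5 / Cor. 3.6 (Manin–Drinfeld)]
-/

set_option autoImplicit false
-- lint-debt: the directory name repeats the summit name (sibling precedent `ManinLocalTwoThreeShimuraQuotientFrickeParity.lean`)
set_option linter.dupNamespace false

noncomputable section

open scoped MatrixGroups ModularForm
open CongruenceSubgroup Complex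
open WeierstrassCurve Literature.NumberTheory.EllipticCurves Literature.NumberTheory.EllipticCurves.ModularForms

namespace Summit.BirchSwinnertonDyer.BirchSwinnertonDyer.Theorems.ManinLocalTwoThree.SigmaHabitat

variable {W W₁ : WeierstrassCurve ℚ} [W.IsElliptic] [W.IsGloballyMinimal] {N : ℕ} [NeZero N]

/-! ## §1 `φ₀(0) = O` ⟹ `Λ₁(f) = Λ₀(f)` -/

/-- **STEVENS' CURVE IS THE OPTIMAL CURVE WHEN THE CUSP `0` MAPS TO THE ORIGIN** (modulo F★, F♮, CES): for a lattice-optimal `X₀(N)`-datum `D` of a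
globally minimal `W`, `{∞,0}_f ∈ Λ₀(f)` ⟹ `Λ₁(f) = Λ₀(f)` (Θ at `m = 1`). [cite: Stevens1982, Thm. 1.3.1] [cite: ConradEdixhovenStein2003, §6.1.2] -/
theorem periodLatticeGamma1_eq_of_modularSymbol_zero_mem_of_print (hF : optimalGamma1Parametrization_cusp_rational)
    (hFnat : optimalGamma1Parametrization_cuspZero_galoisConjugate) (hCES : exists_optimal_gamma1ParametrizationData)
    (D : ModularParametrizationData W N) (hopt : ∀ z ∈ D.L.lattice, ∃ w ∈ periodLattice D.f, z = D.c * w)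
    (h0 : modularSymbol D.f 0 ∈ periodLattice D.f) : periodLatticeGamma1 D.f = periodLattice D.f := by
  refine le_antisymm (periodLatticeGamma1_le_periodLattice D.f) fun x hx ↦ ?_
  have h := CuspGalois.cuspZeroAnnihilates_of_latticeOptimal hFnat hF hCES D hopt 1 (by simpa using h0) x hx
  simpa using h

/-- **`{∞,0}_f = 0` (e.g. `L(f,1) = 0`) ⟹ `Λ₁(f) = Λ₀(f)`** (modulo F★, F♮, CES). [cite: Stevens1989, §2] -/
theorem periodLatticeGamma1_eq_of_modularSymbol_zero_eq_zero_of_print (hF : optimalGamma1Parametrization_cusp_rational)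
    (hFnat : optimalGamma1Parametrization_cuspZero_galoisConjugate) (hCES : exists_optimal_gamma1ParametrizationData)
    (D : ModularParametrizationData W N) (hopt : ∀ z ∈ D.L.lattice, ∃ w ∈ periodLattice D.f, z = D.c * w)
    (h0 : modularSymbol D.f 0 = 0) : periodLatticeGamma1 D.f = periodLattice D.f :=
  periodLatticeGamma1_eq_of_modularSymbol_zero_mem_of_print hF hFnat hCES D hopt (by rw [h0]; exact zero_mem _)

/-! ## §2 Fricke-plus newforms / root number `−1` -/

/-- **`w_N f = +f` ⟹ `Λ₁(f) = Λ₀(f)`** (modulo F★, F♮, CES): `2·{∞,0}_f = 0` by the Fricke flip. [cite: AtkinLehner1970, Thm. 3] -/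
theorem periodLatticeGamma1_eq_of_isFrickeEigen_one_of_print (hF : optimalGamma1Parametrization_cusp_rational)
    (hFnat : optimalGamma1Parametrization_cuspZero_galoisConjugate) (hCES : exists_optimal_gamma1ParametrizationData)
    (D : ModularParametrizationData W N) (hopt : ∀ z ∈ D.L.lattice, ∃ w ∈ periodLattice D.f, z = D.c * w)
    (hW : IsFrickeEigen N D.f 1) : periodLatticeGamma1 D.f = periodLattice D.f := by
  refine periodLatticeGamma1_eq_of_modularSymbol_zero_eq_zero_of_print hF hFnat hCES D hopt ?_
  have h := one_add_mul_modularSymbol_zero_eq_zero D.f hW (by norm_num)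
  have h2 : (2 : ℂ) * modularSymbol D.f 0 = 0 := by rw [← h]; ring
  exact (mul_eq_zero.mp h2).resolve_left two_ne_zero

/-- **`ε(f) = frickeEigenvalue f = +1` ⟹ `Λ₁(f) = Λ₀(f)`** (modulo F★, F♮, CES). [cite: AtkinLehner1970, Thm. 3] -/
theorem periodLatticeGamma1_eq_of_frickeEigenvalue_eq_one_of_print (hF : optimalGamma1Parametrization_cusp_rational)
    (hFnat : optimalGamma1Parametrization_cuspZero_galoisConjugate) (hCES : exists_optimal_gamma1ParametrizationData)
    (D : ModularParametrizationData W N) (hopt : ∀ z ∈ D.L.lattice, ∃ w ∈ periodLattice D.f, z = D.c * w)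
    (hε : frickeEigenvalue D.f = 1) : periodLatticeGamma1 D.f = periodLattice D.f := by
  have hW := isFrickeEigen_frickeEigenvalue D
  rw [hε] at hW
  exact periodLatticeGamma1_eq_of_isFrickeEigen_one_of_print hF hFnat hCES D hopt hW

/-- **ROOT NUMBER `−1` ⟹ STEVENS' CURVE = THE OPTIMAL CURVE** (conductor level; modulo F★, F♮, CES): for a lattice-optimal `X₀(N_W)`-datum of a
globally minimal `W` with `w(W) = −1` (odd analytic rank), `Λ₁(f) = Λ₀(f)`. [cite: AtkinLehner1970, Thm. 3] [cite: Stevens1989, §2] -/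
theorem periodLatticeGamma1_eq_of_rootNumber_eq_neg_one_of_print [NeZero (W.conductorNorm ℤ)]
    (hF : optimalGamma1Parametrization_cusp_rational) (hFnat : optimalGamma1Parametrization_cuspZero_galoisConjugate)
    (hCES : exists_optimal_gamma1ParametrizationData) (D : ModularParametrizationData W (W.conductorNorm ℤ))
    (hopt : ∀ z ∈ D.L.lattice, ∃ w ∈ periodLattice D.f, z = D.c * w) (hw : W.rootNumber = -1) :
    periodLatticeGamma1 D.f = periodLattice D.f := by
  have hW := D.isNewformOf.isFrickeEigen_neg_rootNumber
  rw [hw] at hW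
  norm_num at hW
  exact periodLatticeGamma1_eq_of_isFrickeEigen_one_of_print hF hFnat hCES D hopt hW

/-! ## §3 `|c₀| = |c₁|` on the locus `φ₀(0) = O` (E-an-151 there, modulo print) -/

/-- **`|c₀| = |c₁|` when the cusp `0` maps to the origin** (lattice-optimal `D₀` of minimal `W`, Stevens' optimal `X₁(N)`-datum `D₁` of an isogenous
minimal `W₁`; modulo F★, F♮, CES). [cite: Stevens1989, §2] [cite: ConradEdixhovenStein2003, Thm. 1.1.3] -/
theorem natAbs_maninConstant₀_eq_of_modularSymbol_zero_mem_of_print [W₁.IsElliptic] [W₁.IsGloballyMinimal]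
    (hF : optimalGamma1Parametrization_cusp_rational) (hFnat : optimalGamma1Parametrization_cuspZero_galoisConjugate)
    (hCES : exists_optimal_gamma1ParametrizationData) (D₁ : Gamma1ParametrizationData W₁ N) (D₀ : ModularParametrizationData W N)
    (hiso : IsIsogenous W₁ W) (h₁ : D₁.IsOptimal) (h₀ : ∀ z ∈ D₀.L.lattice, ∃ w ∈ periodLattice D₀.f, z = D₀.c * w)
    (h0 : modularSymbol D₀.f 0 ∈ periodLattice D₀.f) : D₀.maninConstant.natAbs = D₁.maninConstant.natAbs :=
  natAbs_maninConstant₀_eq_of_periodLatticeGamma1_eq_periodLattice D₁ D₀ h₁ h₀ (D₁.f_eq_of_isIsogenous D₀ hiso)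
    (periodLatticeGamma1_eq_of_modularSymbol_zero_mem_of_print hF hFnat hCES D₀ h₀ h0)

/-- **`|c₀| = |c₁|` for every optimal curve of ROOT NUMBER `−1`** (conductor level; modulo F★, F♮, CES) — E-an-151 `GammaOneTransferAtFour` and its
`p = 3` twin hold on the odd-analytic-rank half with no further input. [cite: Stevens1989, §2] [cite: AtkinLehner1970, Thm. 3] -/
theorem natAbs_maninConstant₀_eq_of_rootNumber_eq_neg_one_of_print [W₁.IsElliptic] [W₁.IsGloballyMinimal] [NeZero (W.conductorNorm ℤ)]
    (hF : optimalGamma1Parametrization_cusp_rational) (hFnat : optimalGamma1Parametrization_cuspZero_galoisConjugate)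
    (hCES : exists_optimal_gamma1ParametrizationData) (D₁ : Gamma1ParametrizationData W₁ (W.conductorNorm ℤ))
    (D₀ : ModularParametrizationData W (W.conductorNorm ℤ)) (hiso : IsIsogenous W₁ W) (h₁ : D₁.IsOptimal)
    (h₀ : ∀ z ∈ D₀.L.lattice, ∃ w ∈ periodLattice D₀.f, z = D₀.c * w) (hw : W.rootNumber = -1) :
    D₀.maninConstant.natAbs = D₁.maninConstant.natAbs :=
  natAbs_maninConstant₀_eq_of_periodLatticeGamma1_eq_periodLattice D₁ D₀ h₁ h₀ (D₁.f_eq_of_isIsogenous D₀ hiso)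
    (periodLatticeGamma1_eq_of_rootNumber_eq_neg_one_of_print hF hFnat hCES D₀ h₀ hw)

/-! ## §4 A Shimura `p`-kernel needs `p ∣ ord φ₀(0)`: at `4 ∣ N` the cuspidal point has EVEN order, at `9 ∣ N` order divisible by `3` -/

/-- **Coprime annihilators collapse the quotient** (modulo F★, F♮, CES): if `p·Λ₀ ⊆ Λ₁` (e.g. `p` traceless with `p² ∣ N`) and `m·{∞,0}_f ∈ Λ₀(f)` with
`gcd(p, m) = 1`, then `Λ₁(f) = Λ₀(f)` (Θ gives `m·Λ₀ ⊆ Λ₁`; Bézout). [cite: Stevens1982, Thm. 1.3.1] [cite: LingOesterle1991, Thm. 6] -/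
theorem periodLatticeGamma1_eq_of_natMul_mem_of_coprime_cuspZero_of_print (hF : optimalGamma1Parametrization_cusp_rational)
    (hFnat : optimalGamma1Parametrization_cuspZero_galoisConjugate) (hCES : exists_optimal_gamma1ParametrizationData)
    (D : ModularParametrizationData W N) (hopt : ∀ z ∈ D.L.lattice, ∃ w ∈ periodLattice D.f, z = D.c * w)
    {p m : ℕ} (hp : ∀ z ∈ periodLattice D.f, (p : ℂ) * z ∈ periodLatticeGamma1 D.f)
    (hm : (m : ℂ) * modularSymbol D.f 0 ∈ periodLattice D.f) (hcop : Nat.Coprime p m) :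
    periodLatticeGamma1 D.f = periodLattice D.f := by
  refine le_antisymm (periodLatticeGamma1_le_periodLattice D.f) fun z hz ↦ ?_
  have hΘ := CuspGalois.cuspZeroAnnihilates_of_latticeOptimal hFnat hF hCES D hopt m hm z hz
  obtain ⟨α, β, hαβ⟩ := Nat.isCoprime_iff_coprime.mpr hcop
  have h1 : (α : ℂ) * (p : ℂ) + (β : ℂ) * (m : ℂ) = 1 := by exact_mod_cast hαβ
  have key : z = (α : ℂ) * ((p : ℂ) * z) + (β : ℂ) * ((m : ℂ) * z) := by linear_combination -z * h1
  rw [key]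
  have ha := (periodLatticeGamma1 D.f).zsmul_mem (hp z hz) α
  have hb := (periodLatticeGamma1 D.f).zsmul_mem hΘ β
  rw [zsmul_eq_mul] at ha hb
  exact add_mem ha hb

/-- **At `4 ∣ N`: `Λ₁(f) ≠ Λ₀(f)` ⟹ every `m` with `m·{∞,0}_f ∈ Λ₀(f)` is EVEN** — the cuspidal point `φ₀(0) ∈ E₀(ℚ)_tors` has even order (modulo F★,
F♮, CES).  Hence the Shimura `2`-kernel of C2 (index `2` or `4`; rows E-an-152/152b/153) lives only on analytic-rank-`0` curves with a rational point of
even order. [cite: Stevens1982, Thm. 1.3.1] [cite: LingOesterle1991, Thm. 6] -/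
theorem even_of_natMul_modularSymbol_zero_mem_of_ne_of_four_dvd_of_print (hF : optimalGamma1Parametrization_cusp_rational)
    (hFnat : optimalGamma1Parametrization_cuspZero_galoisConjugate) (hCES : exists_optimal_gamma1ParametrizationData)
    (D : ModularParametrizationData W N) (hopt : ∀ z ∈ D.L.lattice, ∃ w ∈ periodLattice D.f, z = D.c * w) (h4 : 2 ^ 2 ∣ N)
    (hne : periodLatticeGamma1 D.f ≠ periodLattice D.f) {m : ℕ} (hm : (m : ℂ) * modularSymbol D.f 0 ∈ periodLattice D.f) : Even m := by
  by_contra hodd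
  rw [Nat.not_even_iff_odd] at hodd
  exact hne (periodLatticeGamma1_eq_of_natMul_mem_of_coprime_cuspZero_of_print hF hFnat hCES D hopt
    (fun z hz ↦ by exact_mod_cast two_mul_mem_periodLatticeGamma1_of_four_dvd D h4 hz) hm
    (Nat.coprime_two_left.mpr hodd))

/-- **At `4 ∣ N`: `Λ₁(f) ≠ Λ₀(f)` ⟹ `{∞,0}_f ∉ Λ₀(f)`** (so `{∞,0}_f ≠ 0`: `L(f,1) ≠ 0`, analytic rank `0`; modulo F★, F♮, CES). -/
theorem modularSymbol_zero_not_mem_of_ne_of_print (hF : optimalGamma1Parametrization_cusp_rational)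
    (hFnat : optimalGamma1Parametrization_cuspZero_galoisConjugate) (hCES : exists_optimal_gamma1ParametrizationData)
    (D : ModularParametrizationData W N) (hopt : ∀ z ∈ D.L.lattice, ∃ w ∈ periodLattice D.f, z = D.c * w)
    (hne : periodLatticeGamma1 D.f ≠ periodLattice D.f) : modularSymbol D.f 0 ∉ periodLattice D.f :=
  fun h0 ↦ hne (periodLatticeGamma1_eq_of_modularSymbol_zero_mem_of_print hF hFnat hCES D hopt h0)

/-- **At `4 ∣ N`: index `4` (`Λ₁ = 2Λ₀`, the negation of E-an-152b) ⟹ `{∞,0}_f ∉ Λ₀(f)`** (modulo F★, F♮, CES) — E-an-152b is automatic on the locus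
`φ₀(0) = O` ⊇ {root number `−1`}. -/
theorem modularSymbol_zero_not_mem_of_index_four_of_print (hF : optimalGamma1Parametrization_cusp_rational)
    (hFnat : optimalGamma1Parametrization_cuspZero_galoisConjugate) (hCES : exists_optimal_gamma1ParametrizationData)
    (D : ModularParametrizationData W N) (hopt : ∀ z ∈ D.L.lattice, ∃ w ∈ periodLattice D.f, z = D.c * w)
    (hidx : ∀ z : ℂ, z ∈ periodLatticeGamma1 D.f ↔ ∃ w ∈ periodLattice D.f, z = 2 * w) :
    modularSymbol D.f 0 ∉ periodLattice D.f := by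
  refine modularSymbol_zero_not_mem_of_ne_of_print hF hFnat hCES D hopt fun heq ↦ ?_
  -- index `4` with `Λ₁ = Λ₀` would give `Λ₀ = 2Λ₀`, impossible for the non-zero lattice `Λ₀ = c⁻¹Λ_W`
  have hc : (D.c : ℂ) ≠ 0 := D.cast_c_ne_zero
  have hω : D.L.ω₁ / (D.c : ℂ) ∈ periodLattice D.f := by
    obtain ⟨w, hw, hEq⟩ := hopt _ D.L.ω₁_mem_lattice
    rwa [hEq, mul_div_cancel_left₀ _ hc]
  -- iterate: every element of `Λ₀` is divisible by `2^k` in `Λ₀`; use discreteness via the `ℤ`-basis: `ω₁/c = 2 w`, `w ∈ Λ₀ ⊆ c⁻¹Λ_W`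
  have hω' : D.L.ω₁ / (D.c : ℂ) ∈ periodLatticeGamma1 D.f := by rw [heq]; exact hω
  obtain ⟨w, hw, hEq⟩ := (hidx _).mp hω'
  have hwL : (D.c : ℂ) * w ∈ D.L.lattice := D.smul_periodLattice_le w hw
  obtain ⟨a, b, hab⟩ := PeriodPair.mem_lattice.mp hwL
  -- `ω₁ = 2 c w = 2a ω₁ + 2b ω₂` ⟹ `(2a − 1) ω₁ + 2b ω₂ = 0` ⟹ `2a = 1`, absurd
  have e1 : D.L.ω₁ = 2 * ((D.c : ℂ) * w) := by
    have h := (div_eq_iff hc).mp hEq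
    rw [h]; ring
  have hrel : ((2 * a - 1 : ℤ) : ℂ) * D.L.ω₁ + ((2 * b : ℤ) : ℂ) * D.L.ω₂ = 0 := by
    push_cast
    linear_combination 2 * hab - e1
  have h := PeriodPair.intCast_pair_eq_zero D.L hrel
  omega

end Summit.BirchSwinnertonDyer.BirchSwinnertonDyer.Theorems.ManinLocalTwoThree.SigmaHabitat

end
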